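import Summits.ValiantsHypothesis.ValiantsHypothesis.Theorems.GrenetZeonDualUnipotentThreeHalvesLongMassTraceTriangularisable
import Summits.ValiantsHypothesis.ValiantsHypothesis.Theorems.GrenetZeonDualUnipotentThreeHalvesLongMassTriangularTwo
import Summits.ValiantsHypothesis.ValiantsHypothesis.Theorems.GrenetZeonDualUnipotentThreeHalvesLongMassNilSpaceTraceCriterion

/-!
# `GrenetZeon.DualUnipotentThreeHalves` (stmt-ValiantsHypothesis-24318), stub (c) — THE PERMUTABLE-TRACE ROW:
# a nil value space whose generator commutators are trace-orthogonal to its envelope is triangularisable, hence (c) holds on it at `c = 2`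

leafhand-val-grenetzeon-2 gen29 (30th hand), 2026-09-01; sequel of `…LongMassTraceTriangularisable` (p843523, Radjavi's trace criterion BY NAME).

WHY.  The (c)-menu's triangularisable locus has three interchangeable descriptions by name (27th hand: constant basis `∃ P`,
associative envelope ✓ `NilSpaceEngel.conj_strictUpper_iff_words_eq_zero` / ✓ `conj_strictUpper_iff_trace_words_eq_zero`, Lie envelope
✓ `conj_strictUpper_iff_exists_lieClosed_nil`).  This file adds the FOURTH, the cheapest to TEST on a candidate species: for a linear space
`V ≤ M_b(ℂ)` of nilpotent matrices,

  `V` is simultaneously strictly upper triangularisable ⟺ `tr((AB − BA)·u) = 0` for all `A, B ∈ V`, `u ∈ ℂ⟨V⟩`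
  ⟺ the trace is permutable on the unital envelope `ℂ⟨V⟩` (`tr(acu) = tr(cau)`),

i.e. only the commutators of GENERATORS need testing against the envelope (Radjavi–Rosenthal Thm. 2.2.1 / McCoy, through p843523).  Consequently
the value space of an affine pencil passing this test carries `RelCert n m N (2·(⌊√n⌋·m))` (✓ `TriangularRow.relCert_of_valueSpace_triangularisable_two`):
the PERMUTABLE-TRACE ROW of the (c)-menu, and the violator portrait reads: a (c)-violator's value space has two members `A, B` and an envelope
element `u` with `tr((AB − BA)u) ≠ 0` (sharper by name than «some word has non-zero trace»: the witness word may be taken of the form `[A,B]·u`).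

* `blockTriangular_conj_of_forall_mem` — if `S⁻¹AS` is upper triangular for all `A ∈ V` then so is `S⁻¹aS` for every `a ∈ ℂ⟨V⟩`.
* ★ `conj_strictUpper_iff_commutator_traceOrth` — `∃ P, P V P⁻¹ ⊆ 𝔫  ⟺  V nil ∧ ∀ A B ∈ V, ∀ u ∈ ℂ⟨V⟩, tr((AB − BA)u) = 0`.
* ★ `conj_strictUpper_iff_trace_permutable` — `⟺  V nil ∧ tr permutable on ℂ⟨V⟩`.
* `commutator_traceOrth_iff_trace_words_eq_zero` — equivalence with the 27th hand's traceless-words criterion, by name.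
* ★ `relCert_of_valueSpace_commutator_traceOrth` / `relCert_of_valueSpace_trace_permutable` — the ROW at `c = 2`; `longMass_on_tracePermutable_locus_two`
  — (c)'s conclusion on this locus in the binder shape of the stub.

Honest framing.  Helper (`--supports stmt-ValiantsHypothesis-24318`), classical content; NOT progress on the research stub (c)
`SlowCore.LongMassSlowLawInv` beyond a dictionary row; closes no stub; S3, 24318, 8062 and `VP ≠ VNP` are NOT proved.  Def-free, no sorry, standard axioms.
[cite: RadjaviRosenthal2000, Thm. 2.2.1 (§2.2 Permutable Trace, p. 33)] [cite: HornJohnson2013, Thm. 2.4.8.7 (p0162)]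
-/

set_option linter.dupNamespace false
set_option autoImplicit false

noncomputable section

namespace Summit.ValiantsHypothesis.ValiantsHypothesis.Theorems.GrenetZeon.TraceTriangularisable

open Matrix
open scoped BigOperators
open Summit.ValiantsHypothesis.ValiantsHypothesis.Cruxes.TwoDimCoefficients.DimTwoCases (AffMat IsAffine)
open Summit.ValiantsHypothesis.ValiantsHypothesis.Theorems.GrenetZeon.SlowCore (RelCert)
open Summit.ValiantsHypothesis.ValiantsHypothesis.Theorems.GrenetZeon.NilSpaceEngel
  (apply_eq_zero_of_blockTriangular_of_isNilpotent pow_eq_zero_of_conj_strictUpper conj_strictUpper_iff_trace_words_eq_zero)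
open Summit.ValiantsHypothesis.ValiantsHypothesis.Theorems.GrenetZeon.TriangularRow (relCert_of_valueSpace_triangularisable_two)

variable {b : ℕ}

/-! ## §1 Conjugation into the upper triangular matrices extends from generators to the envelope -/

/-- If `S⁻¹ A S` is upper triangular for every `A` in a set `V`, then `S⁻¹ a S` is upper triangular for every `a` in the unital algebra `ℂ⟨V⟩`
(`a ↦ S⁻¹ a S` is a unital algebra morphism and upper triangular matrices form a subalgebra). [folklore] -/
theorem blockTriangular_conj_of_forall_mem (S : Matrix (Fin b) (Fin b) ℂ) (hS : IsUnit S) (V : Set (Matrix (Fin b) (Fin b) ℂ))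
    (hV : ∀ A ∈ V, (S⁻¹ * A * S).BlockTriangular id) :
    ∀ a ∈ Algebra.adjoin ℂ V, (S⁻¹ * a * S).BlockTriangular id := by
  have hSdet : IsUnit S.det := (Matrix.isUnit_iff_isUnit_det S).mp hS
  intro a ha
  induction ha using Algebra.adjoin_induction with
  | mem x hx => exact hV x hx
  | algebraMap r =>
    rw [Algebra.algebraMap_eq_smul_one, Matrix.mul_smul, Matrix.mul_one, Matrix.smul_mul, Matrix.nonsing_inv_mul S hSdet,
      Matrix.smul_one_eq_diagonal]
    exact Matrix.blockTriangular_diagonal _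
  | add x y _ _ hx hy =>
    rw [Matrix.mul_add, Matrix.add_mul]
    exact hx.add hy
  | mul x y _ _ hx hy =>
    have e : S⁻¹ * (x * y) * S = (S⁻¹ * x * S) * (S⁻¹ * y * S) := by
      calc S⁻¹ * (x * y) * S = S⁻¹ * x * (S * S⁻¹) * y * S := by
            rw [Matrix.mul_nonsing_inv S hSdet, Matrix.mul_one, Matrix.mul_assoc S⁻¹ x y]
        _ = (S⁻¹ * x * S) * (S⁻¹ * y * S) := by simp only [Matrix.mul_assoc]
    rw [e]
    exact hx.mul hy

/-! ## §2 Nil spaces: strictly triangularisable ⟺ generator commutators trace-orthogonal to the envelope ⟺ permutable trace -/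

/-- ★ **GENERATOR-COMMUTATOR CRITERION for nil spaces.**  For a linear space `V ≤ M_b(ℂ)`: ONE unit `P` makes every `P A P⁻¹` (`A ∈ V`) strictly
upper triangular iff `V` consists of nilpotent matrices and `tr((AB − BA)·u) = 0` for all `A, B ∈ V` and all `u` in the unital envelope `ℂ⟨V⟩`.
[cite: RadjaviRosenthal2000, Thm. 2.2.1] [cite: HornJohnson2013, Thm. 2.4.8.7] -/
theorem conj_strictUpper_iff_commutator_traceOrth (V : Submodule ℂ (Matrix (Fin b) (Fin b) ℂ)) :
    (∃ P : (Matrix (Fin b) (Fin b) ℂ)ˣ, ∀ A ∈ V, ∀ i j : Fin b, j ≤ i →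
        ((P : Matrix (Fin b) (Fin b) ℂ) * A * (↑P⁻¹ : Matrix (Fin b) (Fin b) ℂ)) i j = 0) ↔
      (∀ A ∈ V, IsNilpotent A) ∧
        ∀ A ∈ V, ∀ B ∈ V, ∀ u ∈ Algebra.adjoin ℂ (V : Set (Matrix (Fin b) (Fin b) ℂ)),
          Matrix.trace ((A * B - B * A) * u) = 0 := by
  -- the family indexed by `V` generates `ℂ⟨V⟩`
  have hgen : Algebra.adjoin ℂ (Set.range (fun A : V => (A : Matrix (Fin b) (Fin b) ℂ))) =
      Algebra.adjoin ℂ (V : Set (Matrix (Fin b) (Fin b) ℂ)) := by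
    rw [Subtype.range_coe_subtype]
    rfl
  have key := exists_isUnit_conj_iff_traceOrth (fun A : V => (A : Matrix (Fin b) (Fin b) ℂ))
  rw [hgen] at key
  constructor
  · rintro ⟨P, hP⟩
    refine ⟨fun A hA => ⟨b, pow_eq_zero_of_conj_strictUpper P A (hP A hA)⟩, ?_⟩
    -- `S = P⁻¹` triangularises the family
    have hfam : ∃ S : Matrix (Fin b) (Fin b) ℂ, IsUnit S ∧
        ∀ k : V, (S⁻¹ * (k : Matrix (Fin b) (Fin b) ℂ) * S).BlockTriangular id := by
      refine ⟨(↑P⁻¹ : Matrix (Fin b) (Fin b) ℂ), Units.isUnit P⁻¹, fun k => ?_⟩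
      rw [← Matrix.coe_units_inv, inv_inv]
      intro i j hij
      exact hP k k.2 i j (le_of_lt hij)
    intro A hA B hB u hu
    exact key.1 hfam ⟨A, hA⟩ ⟨B, hB⟩ u hu
  · rintro ⟨hnil, h⟩
    obtain ⟨S, hS, hT⟩ := key.2 fun k l u hu => h k k.2 l l.2 u hu
    obtain ⟨U, rfl⟩ := hS
    refine ⟨U⁻¹, fun A hA i j hji => ?_⟩
    rw [inv_inv, Matrix.coe_units_inv]
    have htri : ((U : Matrix (Fin b) (Fin b) ℂ)⁻¹ * A * (U : Matrix (Fin b) (Fin b) ℂ)).BlockTriangular id := hT ⟨A, hA⟩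
    have hnil' : IsNilpotent ((U : Matrix (Fin b) (Fin b) ℂ)⁻¹ * A * (U : Matrix (Fin b) (Fin b) ℂ)) := by
      obtain ⟨k, hk⟩ := hnil A hA
      exact ⟨k, by rw [← Matrix.coe_units_inv, Units.conj_pow', hk, Matrix.mul_zero, Matrix.zero_mul]⟩
    exact apply_eq_zero_of_blockTriangular_of_isNilpotent htri hnil' hji

/-- ★ **PERMUTABLE-TRACE CRITERION for nil spaces.**  For a linear space `V ≤ M_b(ℂ)`: ONE unit `P` makes every `P A P⁻¹` (`A ∈ V`) strictly upper
triangular iff `V` consists of nilpotent matrices and the trace is permutable on the unital envelope `ℂ⟨V⟩` (`tr(acu) = tr(cau)`).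
[cite: RadjaviRosenthal2000, Thm. 2.2.1 (§2.2 Permutable Trace)] -/
theorem conj_strictUpper_iff_trace_permutable (V : Submodule ℂ (Matrix (Fin b) (Fin b) ℂ)) :
    (∃ P : (Matrix (Fin b) (Fin b) ℂ)ˣ, ∀ A ∈ V, ∀ i j : Fin b, j ≤ i →
        ((P : Matrix (Fin b) (Fin b) ℂ) * A * (↑P⁻¹ : Matrix (Fin b) (Fin b) ℂ)) i j = 0) ↔
      (∀ A ∈ V, IsNilpotent A) ∧
        ∀ a ∈ Algebra.adjoin ℂ (V : Set (Matrix (Fin b) (Fin b) ℂ)), ∀ c ∈ Algebra.adjoin ℂ (V : Set (Matrix (Fin b) (Fin b) ℂ)),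
          ∀ u ∈ Algebra.adjoin ℂ (V : Set (Matrix (Fin b) (Fin b) ℂ)), Matrix.trace (a * c * u) = Matrix.trace (c * a * u) := by
  constructor
  · rintro ⟨P, hP⟩
    refine ⟨fun A hA => ⟨b, pow_eq_zero_of_conj_strictUpper P A (hP A hA)⟩, ?_⟩
    apply (exists_isUnit_conj_iff_trace_permutable (Algebra.adjoin ℂ (V : Set (Matrix (Fin b) (Fin b) ℂ)))).1
    -- `S = P⁻¹` conjugates the generators, hence the envelope, into the upper triangular matrices
    have hgen : ∀ A ∈ (V : Set (Matrix (Fin b) (Fin b) ℂ)),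
        ((↑P⁻¹ : Matrix (Fin b) (Fin b) ℂ)⁻¹ * A * (↑P⁻¹ : Matrix (Fin b) (Fin b) ℂ)).BlockTriangular id := by
      intro A hA
      rw [← Matrix.coe_units_inv, inv_inv]
      intro i j hij
      exact hP A hA i j (le_of_lt hij)
    exact ⟨(↑P⁻¹ : Matrix (Fin b) (Fin b) ℂ), Units.isUnit P⁻¹,
      blockTriangular_conj_of_forall_mem _ (Units.isUnit P⁻¹) (V : Set (Matrix (Fin b) (Fin b) ℂ)) hgen⟩
  · rintro ⟨hnil, hperm⟩
    obtain ⟨S, hS, hT⟩ :=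
      (exists_isUnit_conj_iff_trace_permutable (Algebra.adjoin ℂ (V : Set (Matrix (Fin b) (Fin b) ℂ)))).2 hperm
    obtain ⟨U, rfl⟩ := hS
    refine ⟨U⁻¹, fun A hA i j hji => ?_⟩
    rw [inv_inv, Matrix.coe_units_inv]
    have hA' : A ∈ Algebra.adjoin ℂ (V : Set (Matrix (Fin b) (Fin b) ℂ)) := Algebra.subset_adjoin hA
    have htri : ((U : Matrix (Fin b) (Fin b) ℂ)⁻¹ * A * (U : Matrix (Fin b) (Fin b) ℂ)).BlockTriangular id := hT A hA'
    have hnil' : IsNilpotent ((U : Matrix (Fin b) (Fin b) ℂ)⁻¹ * A * (U : Matrix (Fin b) (Fin b) ℂ)) := by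
      obtain ⟨k, hk⟩ := hnil A hA
      exact ⟨k, by rw [← Matrix.coe_units_inv, Units.conj_pow', hk, Matrix.mul_zero, Matrix.zero_mul]⟩
    exact apply_eq_zero_of_blockTriangular_of_isNilpotent htri hnil' hji

/-! ## §3 The two trace criteria agree by name -/

/-- For a linear space `V ≤ M_b(ℂ)`: «`V` nil and every generator commutator trace-orthogonal to `ℂ⟨V⟩`» iff «every `V`-word of positive
length is traceless» (✓ `NilSpaceEngel.conj_strictUpper_iff_trace_words_eq_zero`) — both say `V` is simultaneously strictly triangularisable.
[cite: RadjaviRosenthal2000, Thm. 2.2.1] -/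
theorem commutator_traceOrth_iff_trace_words_eq_zero (V : Submodule ℂ (Matrix (Fin b) (Fin b) ℂ)) :
    ((∀ A ∈ V, IsNilpotent A) ∧
        ∀ A ∈ V, ∀ B ∈ V, ∀ u ∈ Algebra.adjoin ℂ (V : Set (Matrix (Fin b) (Fin b) ℂ)),
          Matrix.trace ((A * B - B * A) * u) = 0) ↔
      ∀ (s : ℕ) (w : Fin (s + 1) → Matrix (Fin b) (Fin b) ℂ), (∀ t, w t ∈ V) → ((List.ofFn w).prod).trace = 0 :=
  (conj_strictUpper_iff_commutator_traceOrth V).symm.trans (conj_strictUpper_iff_trace_words_eq_zero V)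

/-- Permutable-trace form of the same equivalence. [cite: RadjaviRosenthal2000, Thm. 2.2.1] -/
theorem trace_permutable_iff_trace_words_eq_zero (V : Submodule ℂ (Matrix (Fin b) (Fin b) ℂ)) :
    ((∀ A ∈ V, IsNilpotent A) ∧
        ∀ a ∈ Algebra.adjoin ℂ (V : Set (Matrix (Fin b) (Fin b) ℂ)), ∀ c ∈ Algebra.adjoin ℂ (V : Set (Matrix (Fin b) (Fin b) ℂ)),
          ∀ u ∈ Algebra.adjoin ℂ (V : Set (Matrix (Fin b) (Fin b) ℂ)), Matrix.trace (a * c * u) = Matrix.trace (c * a * u)) ↔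
      ∀ (s : ℕ) (w : Fin (s + 1) → Matrix (Fin b) (Fin b) ℂ), (∀ t, w t ∈ V) → ((List.ofFn w).prod).trace = 0 :=
  (conj_strictUpper_iff_trace_permutable V).symm.trans (conj_strictUpper_iff_trace_words_eq_zero V)

/-! ## §4 The permutable-trace ROW of the (c)-menu (`c = 2`, `n₀ = 0`) -/

section Row

variable {n m : ℕ}

/-- ★ **GENERATOR-COMMUTATOR ROW.**  An affine pencil whose values lie in a nil space `V ≤ M_m(ℂ)` with every generator commutator
trace-orthogonal to the envelope `ℂ⟨V⟩` has `RelCert n m N (2·(⌊√n⌋·m))` — (c)'s conclusion with `c = 2`.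
[cite: RadjaviRosenthal2000, Thm. 2.2.1] -/
theorem relCert_of_valueSpace_commutator_traceOrth (N : AffMat n m) (hN : IsAffine N)
    (V : Submodule ℂ (Matrix (Fin m) (Fin m) ℂ)) (hV : ∀ x : Fin n × Fin n → ℂ, N.map (MvPolynomial.eval x) ∈ V)
    (hnil : ∀ A ∈ V, IsNilpotent A)
    (h : ∀ A ∈ V, ∀ B ∈ V, ∀ u ∈ Algebra.adjoin ℂ (V : Set (Matrix (Fin m) (Fin m) ℂ)), Matrix.trace ((A * B - B * A) * u) = 0) :
    RelCert n m N (2 * (Nat.sqrt n * m)) := by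
  obtain ⟨P, hP⟩ := (conj_strictUpper_iff_commutator_traceOrth V).2 ⟨hnil, h⟩
  exact relCert_of_valueSpace_triangularisable_two N hN V hV P hP

/-- ★ **PERMUTABLE-TRACE ROW.**  An affine pencil whose values lie in a nil space `V ≤ M_m(ℂ)` with permutable trace on `ℂ⟨V⟩` has
`RelCert n m N (2·(⌊√n⌋·m))`. [cite: RadjaviRosenthal2000, Thm. 2.2.1] -/
theorem relCert_of_valueSpace_trace_permutable (N : AffMat n m) (hN : IsAffine N)
    (V : Submodule ℂ (Matrix (Fin m) (Fin m) ℂ)) (hV : ∀ x : Fin n × Fin n → ℂ, N.map (MvPolynomial.eval x) ∈ V)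
    (hnil : ∀ A ∈ V, IsNilpotent A)
    (hperm : ∀ a ∈ Algebra.adjoin ℂ (V : Set (Matrix (Fin m) (Fin m) ℂ)), ∀ c ∈ Algebra.adjoin ℂ (V : Set (Matrix (Fin m) (Fin m) ℂ)),
      ∀ u ∈ Algebra.adjoin ℂ (V : Set (Matrix (Fin m) (Fin m) ℂ)), Matrix.trace (a * c * u) = Matrix.trace (c * a * u)) :
    RelCert n m N (2 * (Nat.sqrt n * m)) := by
  obtain ⟨P, hP⟩ := (conj_strictUpper_iff_trace_permutable V).2 ⟨hnil, hperm⟩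
  exact relCert_of_valueSpace_triangularisable_two N hN V hV P hP

end Row

/-- **(c) ON THE PERMUTABLE-TRACE LOCUS WITH `c = 2`, `n₀ = 0`**, in the binder shape of the stub `SlowCore.LongMassSlowLawInv`: the values of
the pencil lie in a nil space whose generator commutators are trace-orthogonal to its envelope.  (Equivalent by name to the triangularisable locus,
✓ `TriangularRow.longMass_on_triangularisable_locus_two`; what is new is the TEST.) [cite: RadjaviRosenthal2000, Thm. 2.2.1] -/
theorem longMass_on_tracePermutable_locus_two :
    ∀ n b : ℕ, ∀ B : AffMat n b, IsAffine B →
      (∃ V : Submodule ℂ (Matrix (Fin b) (Fin b) ℂ), (∀ x : Fin n × Fin n → ℂ, B.map (MvPolynomial.eval x) ∈ V) ∧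
        (∀ A ∈ V, IsNilpotent A) ∧
        ∀ A ∈ V, ∀ A' ∈ V, ∀ u ∈ Algebra.adjoin ℂ (V : Set (Matrix (Fin b) (Fin b) ℂ)),
          Matrix.trace ((A * A' - A' * A) * u) = 0) →
      RelCert n b B (2 * (Nat.sqrt n * b)) := by
  rintro n b B hB ⟨V, hV, hnil, h⟩
  exact relCert_of_valueSpace_commutator_traceOrth B hB V hV hnil h

end Summit.ValiantsHypothesis.ValiantsHypothesis.Theorems.GrenetZeon.TraceTriangularisable

end
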